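import Summits.HodgeConjecture.HodgeConjecture.Theses.AnchorTransport
import Summits.HodgeConjecture.HodgeConjecture.Theorems.HeckePrymWeilWeilTwelvefoldsSqrtMinus7IsotypicReachCm
import Summits.HodgeConjecture.HodgeConjecture.Theorems.HeckePrymWeilWeilTwelvefoldsSqrtMinus7IsotypicWeilWitnessStep
import Summits.HodgeConjecture.HodgeConjecture.Theorems.HeckePrymWeilWeilTwelvefoldsSqrtMinus7IsotypicDescent
import Summits.HodgeConjecture.HodgeConjecture.Theorems.HeckePrymWeilHeckePrymAnchorsSurfaceProductStep
import HarnessLib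

/-!
# Crux `WeilTwelvefoldsSqrtMinus7` (stmt-HodgeConjecture-1261), line `isotypic-unimodular-saturation` (r2) —
# the CM ANCHOR and the r2 DELIVERABLE: crux ⟸ `WeilVariationalHodge` + ONE named fact

Skeleton r2 (`Cruxes/WeilTwelvefoldsSqrtMinus7/Lines/isotypic_unimodular_saturation.lean`, lead seat c3)
registered three stubs: `stub_weilWitnessStep` (LANDED p122269), `stub_weilFamilyReach` (= the
classical named fact `weilFamily_hyperbolic_weilSystem_reach`, F3: Deligne's polarized Weil family over
the hyperbolic component — the tree has no universal abelian scheme) and `stub_transport7` (C⁺ =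
`WeilVariationalHodge` at `p = 7`, `M = 7`, open).  This file discharges everything else:

* `cmTower`, `cmAnchor` — the CM tower `B^k` of the tree's CM square `B = E × E`
  (`E = ℂ/ℤ[√-7]`, `φ_B = ([√-7], -[√-7])`, `exists_cmSquare_descentPair_algebraic_aiming`): for every
  `k ≥ 1` a `ℚ(√-7)`-Weil `2k`-fold with ALGEBRAIC Weil plane (landed general product step
  `stub_surfaceProductStep_of_exteriorH1`) and a NON-ZERO rational `(k,k)` typed Weil class (the landed
  witness step); at `k = 6` the CM twelvefold that replaces r1's Hecke–Prym anchor — UNCONDITIONAL;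
* `weilTwelvefolds_of_reach_of_transport7` — the r2 composition: crux ⟸ F3 + generic transport (the
  landed `reach_of_cmAnchor`, the landed `stub_descent`, iso-invariance);
* `weilTwelvefolds_of_weilVariationalHodge_of_reach` — **crux ⟸ `WeilVariationalHodge` (stmt-14497) +
  F3**: compared with r1's `weilTwelvefolds_of_weilVariationalHodge_and_facts` (p120989) the named facts
  `Schoen1988_cyclicPrym_weilClasses_algebraic_degreeSeven`, `two_mul_dim_eq_finrank_bettiCohomology`,
  `exists_heckePrymDatum_F21` are GONE from the trust base;
* `weilTwelvefolds_of_variationalHodge_of_reach` — the same from `AnchorTransport.VariationalHodge`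
  (stmt-1076).

CONDITIONAL on exactly the hypotheses spelled out; no `sorry`, no new definition.
-/

noncomputable section

-- single-problem summit (Problem = Summit): the mandated namespace repeats `HodgeConjecture`.
set_option linter.dupNamespace false

open CategoryTheory
open Literature.AlgebraicGeometry Literature.AlgebraicGeometry.Motives
  Literature.AlgebraicGeometry.HodgeTheory Literature.AlgebraicTopology.SingularHomology
open Summit.HodgeConjecture.HodgeConjecture.Theorems.HeckePrymWeilLine (stub_surfaceProductStep_of_exteriorH1)

namespace Summit.HodgeConjecture.HodgeConjecture.Theorems.WeilTwelvefoldsSqrtMinus7.IsotypicUnimodularSaturation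

/-- The sum of a non-zero `(1+i√7)^m`-eigenvector and a `(1-i√7)^m`-eigenvector of the same operator
(`m ≥ 1`) is non-zero: the two eigenvalues differ (`Negative.one_add_I_sqrt7_pow_ne`) and eigenspaces of
distinct eigenvalues are disjoint. [folklore] -/
theorem add_ne_zero_of_mem_eigenspaces {V : Type*} [AddCommGroup V] [Module ℂ V] (T : Module.End ℂ V)
    {m : ℕ} (hm : 1 ≤ m) {x y : V}
    (hx : x ∈ Module.End.eigenspace T ((1 + Complex.I * (Real.sqrt (7 : ℝ) : ℂ)) ^ m))
    (hy : y ∈ Module.End.eigenspace T ((1 - Complex.I * (Real.sqrt (7 : ℝ) : ℂ)) ^ m))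
    (hx0 : x ≠ 0) : x + y ≠ 0 := by
  intro h
  have hxy : x = -y := eq_neg_of_add_eq_zero_left h
  have hx' : x ∈ Module.End.eigenspace T ((1 - Complex.I * (Real.sqrt (7 : ℝ) : ℂ)) ^ m) := by
    rw [hxy]; exact Submodule.neg_mem _ hy
  have hne := Negative.one_add_I_sqrt7_pow_ne m hm
  have hdis : Disjoint (Module.End.eigenspace T ((1 + Complex.I * (Real.sqrt (7 : ℝ) : ℂ)) ^ m))
      (Module.End.eigenspace T ((1 - Complex.I * (Real.sqrt (7 : ℝ) : ℂ)) ^ m)) :=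
    (Module.End.eigenspaces_iSupIndep T).pairwiseDisjoint hne
  exact hx0 ((Submodule.disjoint_def.1 hdis) x hx hx')

/-- **The CM tower `B^k`**: for every `k ≥ 1` there is a complex abelian
`2k`-fold `(Z, φ_Z)`, `φ_Z ≫ φ_Z = -7`, whose strong Weil plane `weilClassesOf Z φ_Z k 7` is ALGEBRAIC
and which carries a non-zero rational `(k,k)`-class of its typed Weil plane — `Z = B^k` for the CM
square `B` of `exists_cmSquare_descentPair_algebraic_aiming` (induction: the landed general product
step `stub_surfaceProductStep_of_exteriorH1` for the plane, the witness step for the class).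
[cite: Schoen1998HodgeWeilAddendum, §10] [cite: vanGeemen1994HodgeAV, proof of Thm. 6.12] -/
theorem cmTower
    {B : AbelianVariety ℂ} {φB : B ⟶ B} (hB : B.dim = 2) (hφB : φB ≫ φB = -((7 : ℤ) • 𝟙 B))
    {bp bm η : complexBetti B.X 2}
    (hbp : bp ∈ Module.End.eigenspace (complexBetti.map (𝟙 B + φB).hom.hom.hom 2).hom
      ((1 + Complex.I * (Real.sqrt (7 : ℝ) : ℂ)) ^ 2))
    (hbm : bm ∈ Module.End.eigenspace (complexBetti.map (𝟙 B + φB).hom.hom.hom 2).hom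
      ((1 - Complex.I * (Real.sqrt (7 : ℝ) : ℂ)) ^ 2))
    (hbr : IsRationalClass (bp + bm)) (hbH : IsOfHodgeType 2 B.X 2 1 1 (bp + bm))
    (hpη : cupProduct (show 2 + 2 = 4 from rfl) bp η ≠ 0) (hmη : cupProduct (show 2 + 2 = 4 from rfl) bm η ≠ 0)
    (hBalg : ∀ b : complexBetti B.X 2,
      b ∈ Module.End.eigenspace (complexBetti.map (𝟙 B + φB).hom.hom.hom 2).hom
            ((1 + Complex.I * (Real.sqrt (7 : ℝ) : ℂ)) ^ 2) ⊔
          Module.End.eigenspace (complexBetti.map (𝟙 B + φB).hom.hom.hom 2).hom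
            ((1 - Complex.I * (Real.sqrt (7 : ℝ) : ℂ)) ^ 2) →
      b ∈ algebraicClasses B.X 1) :
    ∀ k : ℕ, 1 ≤ k → ∃ (Z : AbelianVariety ℂ) (φZ : Z ⟶ Z), Z.dim = 2 * k ∧
      φZ ≫ φZ = -((7 : ℤ) • 𝟙 Z) ∧ weilClassesOf Z φZ k 7 ≤ algebraicClasses Z.X k ∧
      ∃ c : complexBetti Z.X (2 * k), c ≠ 0 ∧ IsRationalClass c ∧
        IsOfHodgeType (2 * k) Z.X (2 * k) k k c ∧
        c ∈ Module.End.eigenspace (complexBetti.map (𝟙 Z + φZ).hom.hom.hom (2 * k)).hom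
              ((1 + Complex.I * (Real.sqrt (7 : ℝ) : ℂ)) ^ (2 * k)) ⊔
            Module.End.eigenspace (complexBetti.map (𝟙 Z + φZ).hom.hom.hom (2 * k)).hom
              ((1 - Complex.I * (Real.sqrt (7 : ℝ) : ℂ)) ^ (2 * k)) := by
  have hφBn : φB ≫ φB = -((7 : ℕ) • 𝟙 B) := by rw [hφB, ← natCast_zsmul]; rfl
  have hφB' : φB ≫ φB = -(((7 : ℕ) : ℤ) • 𝟙 B) := by exact_mod_cast hφB
  have hbp0 : bp ≠ 0 := by
    rintro rfl; exact hpη (by rw [map_zero, LinearMap.zero_apply])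
  have hbm0 : bm ≠ 0 := by
    rintro rfl; exact hmη (by rw [map_zero, LinearMap.zero_apply])
  -- the strong Weil plane of `B` is algebraic
  have hBW : weilClassesOf B φB 1 7 ≤ algebraicClasses B.X 1 :=
    weilClassesOf_le_algebraicClasses_of_eigenspaces B hφBn 1 (by simpa using hBalg)
  intro k hk
  induction k, hk using Nat.le_induction with
  | base =>
    refine ⟨B, φB, hB, hφB, hBW, bp + bm, ?_, hbr, hbH, ?_⟩
    · exact add_ne_zero_of_mem_eigenspaces (m := 2) _ (by norm_num) hbp hbm hbp0
    · exact Submodule.add_mem _ (Submodule.mem_sup_left hbp) (Submodule.mem_sup_right hbm)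
  | succ k hk ih =>
    obtain ⟨Z, φZ, hZ, hφZ, hZW, c, hc0, hcr, hcH, hcW⟩ := ih
    have hφZ' : φZ ≫ φZ = -(((7 : ℕ) : ℤ) • 𝟙 Z) := by exact_mod_cast hφZ
    refine ⟨Z.prod B, AbelianVariety.prodLift (AbelianVariety.fst Z B ≫ φZ) (AbelianVariety.snd Z B ≫ φB),
      ?_, ?_, ?_, ?_⟩
    · rw [AbelianVariety.dim_prod, hZ, hB]; ring
    · exact_mod_cast prodLift_comp_self_eq_neg_zsmul hφZ' hφB'
    · exact stub_surfaceProductStep_of_exteriorH1 abelianVarietyCohomologyExteriorH1_holds 7 (by norm_num)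
        (by norm_num) le_rfl k Z φZ B φB hZ hB hφZ' hφB' hZW hBW
    · exact stub_weilWitnessStep k Z B φZ φB hk hZ hB bp bm hbp hbm hbr hbH hbp0 hbm0 ⟨c, hc0, hcr, hcH, hcW⟩

/-- **The CM anchor (glue): a `ℚ(√-7)`-Weil TWELVEFOLD with an ALGEBRAIC typed Weil plane and a
non-zero rational `(6,6)` Weil class** — `Z = B⁶` (`cmTower`
at `k = 6`, retyped through `eigenspace_sup_eigenspace_eq_weilClassesOf`).  This is what replaces the
Hecke–Prym twelvefold `P′` (F1 Schoen 1988, F2 `dim J = g`, F4 the `F₂₁`-datum) of r1.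
[cite: Schoen1998HodgeWeilAddendum, §10] [cite: vanGeemen1994HodgeAV, proof of Thm. 6.12] -/
theorem cmAnchor :
    ∃ (Z : AbelianVariety ℂ) (φZ : Z ⟶ Z), Z.dim = 12 ∧ φZ ≫ φZ = -((7 : ℤ) • 𝟙 Z) ∧
      (∀ c : complexBetti Z.X 12,
        c ∈ Module.End.eigenspace (complexBetti.map (𝟙 Z + φZ).hom.hom.hom 12).hom
              ((1 + Complex.I * (Real.sqrt (7 : ℝ) : ℂ)) ^ 12) ⊔
            Module.End.eigenspace (complexBetti.map (𝟙 Z + φZ).hom.hom.hom 12).hom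
              ((1 - Complex.I * (Real.sqrt (7 : ℝ) : ℂ)) ^ 12) →
        c ∈ algebraicClasses Z.X 6) ∧
      ∃ c : complexBetti Z.X 12, c ≠ 0 ∧ IsRationalClass c ∧ IsOfHodgeType 12 Z.X 12 6 6 c ∧
        c ∈ Module.End.eigenspace (complexBetti.map (𝟙 Z + φZ).hom.hom.hom 12).hom
              ((1 + Complex.I * (Real.sqrt (7 : ℝ) : ℂ)) ^ 12) ⊔
            Module.End.eigenspace (complexBetti.map (𝟙 Z + φZ).hom.hom.hom 12).hom
              ((1 - Complex.I * (Real.sqrt (7 : ℝ) : ℂ)) ^ 12) := by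
  obtain ⟨B, φB, hB, hφB, ⟨bp, bm, η, hbp, hbm, hbr, hbH, -, hpη, hmη⟩, hBalg, -⟩ :=
    exists_cmSquare_descentPair_algebraic_aiming
  obtain ⟨Z, φZ, hZ, hφZ, hZW, c, hc0, hcr, hcH, hcW⟩ :=
    cmTower hB hφB hbp hbm hbr hbH hpη hmη hBalg 6 (by norm_num)
  have hφZn : φZ ≫ φZ = -((7 : ℕ) • 𝟙 Z) := by rw [hφZ, ← natCast_zsmul]; rfl
  refine ⟨Z, φZ, hZ, hφZ, ?_, c, hc0, hcr, hcH, hcW⟩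
  intro x hx
  refine hZW ?_
  rw [← eigenspace_sup_eigenspace_eq_weilClassesOf Z hφZn 6]
  exact hx

/-- **`WeilTwelvefoldsSqrtMinus7` from F3 (the hyperbolic Weil family) and the generic transport (T) at
relative dimension 14** — the r2 composition with its one provable stub discharged (`cmAnchor`).  Given a
12-fold `(A, φ)` and a rational `(6,6)` Weil class `c`: if `c = 0` it is algebraic; otherwise `reach_of_cmAnchor h₅ cmAnchor`
gives the partner square `B`, the family through `A × B`, and for every rational `(7,7)` Weil class `u` of
`A × B` a global class `𝒰` through `u`, rational `(7,7)` and fibrewise-Weil everywhere and algebraic at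
one fibre; the transport `h₄` carries algebraicity to the fibre `≅ A × B`; iso-invariance returns to
`A × B`; the landed `stub_descent` returns to `A`.
[cite: Deligne1982HodgeCycles, proof of Thm. 4.8] [cite: Schoen1998HodgeWeilAddendum, §10]
[cite: Markman2025SurveySecant, §11.5 Step 2] -/
theorem weilTwelvefolds_of_reach_of_transport7 (h₅ : weilFamily_hyperbolic_weilSystem_reach)
    (h₄ : ∀ ⦃𝒳 S : SchemeOver ℂ⦄ (f : 𝒳 ⟶ S), IsSmoothProjectiveFamily f 14 →
      IrreducibleSpace S.left → AlgebraicGeometry.Smooth S.hom →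
    ∀ (W : complexBetti 𝒳 14),
      (∀ s : ComplexPoints S, IsRationalClass (complexBetti.map (fiberι f s) 14 W) ∧
        IsOfHodgeType 14 (fiberOver f s) 14 7 7 (complexBetti.map (fiberι f s) 14 W)) →
      (∀ s : ComplexPoints S, ∃ (A' : AbelianVariety ℂ) (φ' : A' ⟶ A'),
        A'.dim = 14 ∧ φ' ≫ φ' = -((7 : ℤ) • 𝟙 A') ∧ Nonempty (A'.X ≅ fiberOver f s)) →
      (∃ s₀ : ComplexPoints S,
        complexBetti.map (fiberι f s₀) 14 W ∈ algebraicClasses (fiberOver f s₀) 7) →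
    ∀ s : ComplexPoints S, complexBetti.map (fiberι f s) 14 W ∈ algebraicClasses (fiberOver f s) 7) :
    Summit.HodgeConjecture.HodgeConjecture.Theses.HeckePrymWeil.WeilTwelvefoldsSqrtMinus7 := by
  intro A φ hA hφ c hrat hH hW
  by_cases hc : c = 0
  · rw [hc]
    exact Submodule.zero_mem _
  obtain ⟨B, φB, hB, hφB, hpair, 𝒳, S, f, hf, hirr, hsm, s₁, e₁, hext⟩ :=
    reach_of_cmAnchor h₅ cmAnchor A φ hA hφ ⟨c, hc, hrat, hH, hW⟩
  refine stub_descent A φ B φB hA hB hφ hφB hpair ?_ c hrat hH hW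
  intro u hu huH huW
  obtain ⟨𝒰, hu𝒰, hall, hweil, s₀, halg₀⟩ := hext u hu huH huW
  have hfib : ∀ s : ComplexPoints S, ∃ (A' : AbelianVariety ℂ) (φ' : A' ⟶ A'),
      A'.dim = 14 ∧ φ' ≫ φ' = -((7 : ℤ) • 𝟙 A') ∧ Nonempty (A'.X ≅ fiberOver f s) := by
    intro s
    obtain ⟨Ys, ψs, es, hdim, hψs, -⟩ := hweil s
    exact ⟨Ys, ψs, hdim, hψs, ⟨es⟩⟩
  -- transport to the fibre over `s₁` (Stub 3 = C⁺)
  have h𝒰 : complexBetti.map (fiberι f s₁) 14 𝒰 ∈ algebraicClasses (fiberOver f s₁) 7 :=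
    h₄ f hf hirr hsm 𝒰 hall hfib ⟨s₀, halg₀⟩ s₁
  -- move along the isomorphism `e₁ : A × B ≅ 𝒳_{s₁}`
  have key := mem_algebraicClasses_map_of_iso (p := 7) (hf.isSmoothProjective s₁)
    (AbelianVariety.isSmoothProjective_holds (A := A.prod B)) e₁ h𝒰
  rw [hu𝒰] at key
  exact key

/-- **THE r2 DELIVERABLE: crux `WeilTwelvefoldsSqrtMinus7` (stmt-HodgeConjecture-1261) from the route crux
`WeilVariationalHodge` (stmt-HodgeConjecture-14497) and ONE classical named fact, Deligne's hyperbolic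
Weil family `weilFamily_hyperbolic_weilSystem_reach`** — Schoen 1988 at degree 7, `dim J = g` and the
`F₂₁` Riemann-existence datum of r1 (`weilTwelvefolds_of_weilVariationalHodge_and_facts`, p120989) have
left the trust base: the anchor is the CM twelvefold `B⁶` (`cmAnchor`), on which every Weil class is
algebraic. [cite: Grothendieck1966, footnote 13] [cite: Deligne1982HodgeCycles, proof of Thm. 4.8]
[cite: Schoen1998HodgeWeilAddendum, §10] -/
theorem weilTwelvefolds_of_weilVariationalHodge_of_reach
    (hW : Summit.HodgeConjecture.HodgeConjecture.Theses.HeckePrymWeil.WeilVariationalHodge)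
    (hR : weilFamily_hyperbolic_weilSystem_reach) :
    Summit.HodgeConjecture.HodgeConjecture.Theses.HeckePrymWeil.WeilTwelvefoldsSqrtMinus7 := by
  refine weilTwelvefolds_of_reach_of_transport7 hR ?_
  intro 𝒳 S f hf hirr hsm W hall hfib hanchor s
  have hfib' : ∀ s : ComplexPoints S, ∃ (A' : AbelianVariety ℂ) (φ' : A' ⟶ A'),
      A'.dim = 2 * 7 ∧ φ' ≫ φ' = -(((7 : ℕ) : ℤ) • 𝟙 A') ∧ Nonempty (A'.X ≅ fiberOver f s) := by
    intro s'
    obtain ⟨A', φ', hdim, hφ', hne⟩ := hfib s'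
    exact ⟨A', φ', hdim, by simpa using hφ', hne⟩
  exact hW 7 (by norm_num) (by norm_num) le_rfl 7 (by norm_num) f hf hirr hsm W hall hfib' hanchor s

/-- **The crux from Grothendieck's variational Hodge conjecture `AnchorTransport.VariationalHodge`
(stmt-HodgeConjecture-1076) and the same named fact** (forget the fibrewise Weil structures).
[cite: Grothendieck1966, footnote 13] [cite: CharlesSchnell2014Notes, Conj. 11.3.1] -/
theorem weilTwelvefolds_of_variationalHodge_of_reach
    (hV : Summit.HodgeConjecture.HodgeConjecture.Theses.AnchorTransport.VariationalHodge)
    (hR : weilFamily_hyperbolic_weilSystem_reach) :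
    Summit.HodgeConjecture.HodgeConjecture.Theses.HeckePrymWeil.WeilTwelvefoldsSqrtMinus7 := by
  refine weilTwelvefolds_of_reach_of_transport7 hR ?_
  intro 𝒳 S f hf hirr hsm W hall _ hanchor s
  exact hV f hf hirr hsm 7 W hall hanchor s

end Summit.HodgeConjecture.HodgeConjecture.Theorems.WeilTwelvefoldsSqrtMinus7.IsotypicUnimodularSaturation

end
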